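import Mathlib.Algebra.Homology.DerivedCategory.Ext.ExactSequences
import Mathlib.Algebra.Category.Grp.Zero
import Mathlib.CategoryTheory.Abelian.Projective.Dimension
import Literature.Algebra.Homology.DerivedBoundedSmallHom
import HarnessLib

/-!
# Hyper-Ext groups `HyperExt X K n = Hom_{D(C)}(X[0], K⟦n⟧)` of a cochain complex

For an abelian category `C`, an object `X : C` and a cochain complex `K : CochainComplex C ℤ`,
the **hyper-Ext group** (Weibel, *An introduction to homological algebra*, Def. 10.7.1:
"hyperext `Extⁿ(A, B) = Hom_{D(𝒜)}(A, Tⁿ B)`" for complexes `A`, `B`; here `A = X[0]`)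
`HyperExt X K n` (`n : ℤ`) is the type of morphisms `X[0] ⟶ K⟦n⟧` in the localization of
`CochainComplex C ℤ` at quasi-isomorphisms, shrunk to `Type w` — *literally* Mathlib's
`Abelian.Ext X Y n` (`Mathlib.Algebra.Homology.DerivedCategory.Ext.Basic`) with the single complex
`Y[0]` replaced by an arbitrary complex, so that `Ext X Y n = HyperExt X Y[0] n` by `rfl`
(`ext_eq_hyperExt`, `extEquiv`). With `C` = abelian sheaves and `X = ℤ` this is hypercohomology
(`Literature/AlgebraicGeometry/Crystalline/SheafHypercohomology.lean`).

## Contents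

* `HasHyperExt.{w} X K` — the smallness hypothesis (Mathlib's `HasSmallLocalizedShiftedHom`);
  `hasHyperExt_of_isGE`: it holds for every cohomologically bounded below `K` as soon as
  `HasExt.{w} C` (from `DerivedBoundedSmallHom.lean`); registered as an instance for `K.IsGE 0`
  and for single complexes.
* `HyperExt X K n`, its `AddCommGroup` structure (transported from the constructed derived category
  `HasDerivedCategory.standard C`, exactly as Mathlib does for `Ext`), `hom`/`homAddEquiv`
  (comparison with morphisms in the derived category), functoriality `map` in `K`
  (`map_id`, `map_comp`, `map_eq_of_homotopy`), and `mapEquivOfQuasiIso` (quasi-isomorphisms act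
  by isomorphisms).
* The **long exact sequence** of a short exact sequence `0 → S.X₁ → S.X₂ → S.X₃ → 0` of
  complexes (Weibel Example 10.4.9: it yields an exact triangle in `D(C)`, Mathlib's
  `DerivedCategory.triangleOfSES`; and Example 10.2.8: `Hom_{D}(X[0], -)` is a cohomological
  functor): connecting maps `delta`, exactness `exact₁`, `exact₂`, `exact₃` (also in element form
  `exactᵢ_apply` and as six exact `ComposableArrows`, `sequence_exact`), and naturality
  `delta_naturality` in morphisms of short exact sequences.
* Vanishing `eq_zero_of_isGE` (`n` below the bottom cohomological degree).
* Comparison with `Ext`: `extEquiv`, `extEquiv_comp_mk₀`.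
* **Two-term complexes** `[A →f B]` (`A` in degree `0`): `twoTermComplex f` (the mapping cocone of
  `f[0]`, with `twoTermComplexXZeroIso`, `twoTermComplexXOneIso`, `twoTermComplex_d` : the
  differential is `-f` in these coordinates), the exact sequence
  `⋯ → HyperExt X [A→B] n → Extⁿ(X,A) →f Extⁿ(X,B) →∂ HyperExt X [A→B] (n+1) → ⋯`
  (`twoTerm_exact₁₂₃`, `twoTermFst_injective` in degree `0`).
* **Projective/cohomological dimension**: if `Extⁱ(X, -) = 0` for `i > d`
  (`HasProjectiveDimensionLE X d`) and `K` has cohomology in degrees `[a, b]` then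
  `HyperExt X K n = 0` for `n > b + d` (`eq_zero_of_hasProjectiveDimensionLE`), and
  `Extᵈ(X, B) ↠ HyperExt X [A→B] (d+1)` (`twoTermδ_surjective`).

## Design notes / what is not here

* Statements involving morphisms of the derived category are phrased, as in Mathlib's `Ext` API,
  for the constructed instance `HasDerivedCategory.standard C` (`homAddEquiv`, `homAddEquiv_map`,
  `homAddEquiv_delta`); the plain bijection `hom` is available for any `HasDerivedCategory`.
  Users only ever see intrinsic statements (exactness, naturality, vanishing).
* Not here: the identification of `delta` for `S[0]` with `Ext`'s `· • hS.extClass`; the general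
  stupid filtration (only its two-column case `[A → B]`); `lim`/`lim¹` along towers of complexes;
  products / Yoneda composition with `Ext` classes of positive degree.

## References

* C. A. Weibel, *An introduction to homological algebra*, CUP 1994: Def. 10.7.1 (hyperext),
  Example 10.2.8 (Hom is cohomological), Example 10.4.9 (triangle of a short exact sequence of
  complexes), Application 5.7.10 (hypercohomology). [`Weibel1994`]
* A. A. Beilinson, J. Bernstein, P. Deligne, *Faisceaux pervers*, Astérisque 100 (1982), §1.3
  (t-structures).
-/

universe w w' v u

open CategoryTheory Limits Pretriangulated Triangulated Localization

namespace Literature.Algebra.Homology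

section HyperExt

variable {C : Type u} [Category.{v} C] [Abelian C]

open DerivedCategory Opposite

/-- The smallness hypothesis under which `HyperExt.{w} X K n : Type w` is defined: all the
types of morphisms `X⟦a⟧ ⟶ K⟦b⟧` in the derived category (`X` in degree `0`) are `w`-small.
It holds for `K` cohomologically bounded below as soon as `HasExt.{w} C`
(`hasHyperExt_of_isGE`), in particular for `K` a single complex. [folklore] -/
abbrev HasHyperExt (X : C) (K : CochainComplex C ℤ) : Prop :=
  HasSmallLocalizedShiftedHom.{w} (HomologicalComplex.quasiIso C (ComplexShape.up ℤ)) ℤ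
    ((CochainComplex.singleFunctor C 0).obj X) K

/-- `HasHyperExt.{w} X K` holds for every cohomologically bounded below complex `K` when
`HasExt.{w} C` (e.g. `C` Grothendieck abelian, `w` = its morphism universe). [folklore] -/
theorem hasHyperExt_of_isGE [HasExt.{w} C] (X : C) (K : CochainComplex C ℤ) (b : ℤ)
    [K.IsGE b] : HasHyperExt.{w} X K :=
  hasSmallLocalizedShiftedHom_of_isGE_of_isLE _ K 0 0 b

/-- `HasHyperExt X K` for `K` cohomologically in degrees `≥ 0` (the common case; for other
bounds use `hasHyperExt_of_isGE`). [folklore] -/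
instance (priority := high) [HasExt.{w} C] (X : C) (K : CochainComplex C ℤ) [K.IsGE 0] :
    HasHyperExt.{w} X K :=
  hasHyperExt_of_isGE X K 0

/-- `HasHyperExt X Y[0]` for the `HomologicalComplex.single` spelling of `Y[0]` (the
`CochainComplex.singleFunctor` spelling is `HasExt` itself). [folklore] -/
instance [HasExt.{w} C] (X Y : C) :
    HasHyperExt.{w} X ((HomologicalComplex.single C (ComplexShape.up ℤ) 0).obj Y) :=
  (inferInstance : HasHyperExt.{w} X ((CochainComplex.singleFunctor C 0).obj Y))

/-- The **hyper-Ext group** `HyperExt X K n = Hom_{D(C)}(X[0], K⟦n⟧)` of an object `X` of an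
abelian category `C` with values in a cochain complex `K`, in degree `n : ℤ`: the type of
morphisms from the single complex `X[0]` to `K⟦n⟧` in the localization of `CochainComplex C ℤ`
at quasi-isomorphisms, shrunk to `Type w` (Mathlib's `SmallShiftedHom`, exactly as
`Abelian.Ext X Y n` which is the case `K = Y[0]`, see `HyperExt.extEquiv`). For `C` = abelian
sheaves and `X = ℤ` this is the hypercohomology `ℍⁿ(K)` (Weibel Application 5.7.10, 10.6.8).
[cite: Weibel1994, Def. 10.7.1] -/
def HyperExt (X : C) (K : CochainComplex C ℤ) [HasHyperExt.{w} X K] (n : ℤ) : Type w :=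
  SmallShiftedHom.{w} (HomologicalComplex.quasiIso C (ComplexShape.up ℤ))
    ((CochainComplex.singleFunctor C 0).obj X) K n

namespace HyperExt

section Basic

variable {X : C} {K L M : CochainComplex C ℤ} [HasHyperExt.{w} X K] [HasHyperExt.{w} X L]
  [HasHyperExt.{w} X M] {n : ℤ}

section hom

variable [HasDerivedCategory.{w'} C]

/-- When a derived category is available, the bijection between `HyperExt X K n` and the
type of morphisms `X[0] ⟶ K⟦n⟧` in it. [folklore] -/
noncomputable def hom : HyperExt.{w} X K n ≃ ShiftedHom ((singleFunctor C 0).obj X) (Q.obj K) n :=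
  SmallShiftedHom.equiv _ Q

/-- Two hyper-Ext classes are equal iff the corresponding morphisms in the derived category
are. [folklore] -/
@[ext]
theorem ext {x y : HyperExt.{w} X K n} (h : hom x = hom y) : x = y :=
  hom.injective h

end hom

/-- The abelian group structure on `HyperExt X K n`, transported from the Hom-group in the
(constructed) derived category, as for `Abelian.Ext`. [folklore] -/
noncomputable instance : AddCommGroup (HyperExt.{w} X K n) :=
  letI := HasDerivedCategory.standard C
  (hom (X := X) (K := K) (n := n)).addCommGroup

/-- The additive bijection with morphisms in the constructed derived category
(`HasDerivedCategory.standard`), used to transport constructions. [folklore] -/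
noncomputable def homAddEquiv :
    letI := HasDerivedCategory.standard C
    HyperExt.{w} X K n ≃+ ShiftedHom ((singleFunctor C 0).obj X) (Q.obj K) n :=
  letI := HasDerivedCategory.standard C
  (hom (X := X) (K := K) (n := n)).addEquiv

/-- `homAddEquiv` is `hom`. [folklore] -/
theorem homAddEquiv_apply (x : HyperExt.{w} X K n) :
    letI := HasDerivedCategory.standard C
    homAddEquiv x = hom x :=
  rfl

/-! ### Functoriality in the complex -/

/-- The map `HyperExt X K n →+ HyperExt X L n` induced by a morphism of complexes `K ⟶ L`
(postcomposition in the derived category). [folklore] -/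
noncomputable def map (f : K ⟶ L) (n : ℤ) : HyperExt.{w} X K n →+ HyperExt.{w} X L n :=
  letI := HasDerivedCategory.standard C
  AddMonoidHom.mk' (fun x => homAddEquiv.symm (homAddEquiv x ≫ (Q.map f)⟦n⟧'))
    (fun x y => by rw [map_add, CategoryTheory.Preadditive.add_comp, map_add])

/-- `map` is postcomposition with `Q.map f⟦n⟧` in the (constructed) derived category.
[folklore] -/
theorem homAddEquiv_map (f : K ⟶ L) (x : HyperExt.{w} X K n) :
    letI := HasDerivedCategory.standard C
    homAddEquiv (map f n x) = homAddEquiv x ≫ (Q.map f)⟦n⟧' :=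
  AddEquiv.apply_symm_apply _ _

/-- `map` of the identity. [folklore] -/
@[simp]
theorem map_id (x : HyperExt.{w} X K n) : map (𝟙 K) n x = x := by
  apply homAddEquiv.injective
  rw [homAddEquiv_map, CategoryTheory.Functor.map_id, CategoryTheory.Functor.map_id,
    Category.comp_id]

/-- `map` is compatible with composition. [folklore] -/
theorem map_comp (f : K ⟶ L) (g : L ⟶ M) (x : HyperExt.{w} X K n) :
    map (f ≫ g) n x = map g n (map f n x) := by
  apply homAddEquiv.injective
  rw [homAddEquiv_map, homAddEquiv_map, homAddEquiv_map, CategoryTheory.Functor.map_comp,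
    CategoryTheory.Functor.map_comp, Category.assoc]

/-- `map` of the zero morphism is zero. [folklore] -/
@[simp]
theorem map_zero_hom (x : HyperExt.{w} X K n) : map (0 : K ⟶ L) n x = 0 := by
  apply homAddEquiv.injective
  rw [homAddEquiv_map, CategoryTheory.Functor.map_zero, CategoryTheory.Functor.map_zero,
    Limits.comp_zero, map_zero]

/-- Homotopic morphisms of complexes induce the same map on hyper-Ext groups. [folklore] -/
theorem map_eq_of_homotopy {f g : K ⟶ L} (h : Homotopy f g) (n : ℤ) :
    map (X := X) f n = map g n := by
  refine AddMonoidHom.ext fun x => ?_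
  letI := HasDerivedCategory.standard C
  apply homAddEquiv.injective
  rw [homAddEquiv_map, homAddEquiv_map, DerivedCategory.Q_map_eq_of_homotopy (h := h)]

/-- A quasi-isomorphism `K ⟶ L` induces isomorphisms `HyperExt X K n ≃+ HyperExt X L n`
(hyper-Ext only depends on the class of `K` in the derived category). [folklore] -/
noncomputable def mapEquivOfQuasiIso (f : K ⟶ L) [QuasiIso f] (n : ℤ) :
    HyperExt.{w} X K n ≃+ HyperExt.{w} X L n :=
  letI := HasDerivedCategory.standard C
  { toFun := map f n
    invFun := fun y => homAddEquiv.symm (homAddEquiv y ≫ (inv (Q.map f))⟦n⟧')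
    left_inv := fun x => by
      apply homAddEquiv.injective
      rw [AddEquiv.apply_symm_apply, homAddEquiv_map, Category.assoc,
        ← CategoryTheory.Functor.map_comp, IsIso.hom_inv_id, CategoryTheory.Functor.map_id,
        Category.comp_id]
    right_inv := fun y => by
      apply homAddEquiv.injective
      rw [homAddEquiv_map, AddEquiv.apply_symm_apply, Category.assoc,
        ← CategoryTheory.Functor.map_comp, IsIso.inv_hom_id, CategoryTheory.Functor.map_id,
        Category.comp_id]
    map_add' := fun x y => map_add _ x y }

/-- `mapEquivOfQuasiIso f n` is `map f n`. [folklore] -/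
@[simp]
theorem mapEquivOfQuasiIso_apply (f : K ⟶ L) [QuasiIso f] (x : HyperExt.{w} X K n) :
    mapEquivOfQuasiIso f n x = map f n x :=
  rfl

end Basic

/-! ### The long exact sequence of a short exact sequence of complexes -/

section LES

variable (X : C) {n : ℤ} {S : ShortComplex (CochainComplex C ℤ)} (hS : S.ShortExact)
  [HasHyperExt.{w} X S.X₁] [HasHyperExt.{w} X S.X₂] [HasHyperExt.{w} X S.X₃]

variable {X} in
/-- The **connecting homomorphism** `δ : HyperExt X S.X₃ n₀ →+ HyperExt X S.X₁ n₁`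
(`n₀ + 1 = n₁`) of a short exact sequence `0 → S.X₁ → S.X₂ → S.X₃ → 0` of cochain
complexes: postcomposition with the third morphism of the distinguished triangle
`DerivedCategory.triangleOfSES hS`.
[cite: Weibel1994, Example 10.4.9 and Example 10.2.8] -/
noncomputable def delta (n₀ n₁ : ℤ) (h : n₀ + 1 = n₁) :
    HyperExt.{w} X S.X₃ n₀ →+ HyperExt.{w} X S.X₁ n₁ :=
  letI := HasDerivedCategory.standard C
  AddMonoidHom.mk' (fun x => homAddEquiv.symm (homAddEquiv x ≫ (triangleOfSESδ hS)⟦n₀⟧' ≫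
    (shiftFunctorAdd' (DerivedCategory C) 1 n₀ n₁ (by lia)).inv.app _))
    (fun x y => by rw [map_add, CategoryTheory.Preadditive.add_comp, map_add])

variable {X} in
omit [HasHyperExt.{w} X S.X₂] in
/-- `delta` is the connecting map of the homological functor `Hom(X[0], -)` on the
distinguished triangle of `hS`, in the constructed derived category. [folklore] -/
theorem homAddEquiv_delta (n₀ n₁ : ℤ) (h : n₀ + 1 = n₁) (x : HyperExt.{w} X S.X₃ n₀) :
    letI := HasDerivedCategory.standard C
    homAddEquiv (delta hS n₀ n₁ h x) =
      (preadditiveCoyoneda.obj (op ((singleFunctor C 0).obj X))).homologySequenceδ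
        (triangleOfSES hS) n₀ n₁ h (homAddEquiv x) := by
  letI := HasDerivedCategory.standard C
  rw [preadditiveCoyoneda_homologySequenceδ_apply]
  exact AddEquiv.apply_symm_apply _ _

variable {X} in
omit [HasHyperExt.{w} X S.X₂] in
/-- `delta` in the constructed derived category, unfolded. [folklore] -/
theorem homAddEquiv_delta' (n₀ n₁ : ℤ) (h : n₀ + 1 = n₁) (x : HyperExt.{w} X S.X₃ n₀) :
    letI := HasDerivedCategory.standard C
    homAddEquiv (delta hS n₀ n₁ h x) = homAddEquiv x ≫ (triangleOfSESδ hS)⟦n₀⟧' ≫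
      (shiftFunctorAdd' (DerivedCategory C) 1 n₀ n₁ (by lia)).inv.app _ :=
  AddEquiv.apply_symm_apply _ _

variable {X} in
omit hS [HasHyperExt.{w} X S.X₂] [HasHyperExt.{w} X S.X₃] in
/-- The composite `HyperExt X S.X₁ n → HyperExt X S.X₂ n → HyperExt X S.X₃ n` is zero.
[folklore] -/
theorem map_comp_map_eq_zero [HasHyperExt.{w} X S.X₂] [HasHyperExt.{w} X S.X₃]
    (x : HyperExt.{w} X S.X₁ n) : map S.g n (map S.f n x) = 0 := by
  rw [← map_comp, S.zero, map_zero_hom]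

variable {X} in
/-- The composite `HyperExt X S.X₂ n₀ → HyperExt X S.X₃ n₀ →δ HyperExt X S.X₁ n₁` is zero.
[folklore] -/
theorem delta_map_eq_zero (n₀ n₁ : ℤ) (h : n₀ + 1 = n₁) (x : HyperExt.{w} X S.X₂ n₀) :
    delta hS n₀ n₁ h (map S.g n₀ x) = 0 := by
  letI := HasDerivedCategory.standard C
  apply homAddEquiv.injective
  rw [homAddEquiv_delta, homAddEquiv_map, map_zero]
  exact ConcreteCategory.congr_hom
    ((preadditiveCoyoneda.obj (op ((singleFunctor C 0).obj X))).comp_homologySequenceδ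
      (triangleOfSES hS) (triangleOfSES_distinguished hS) n₀ n₁ h) (homAddEquiv x)

variable {X} in
/-- The composite `HyperExt X S.X₃ n₀ →δ HyperExt X S.X₁ n₁ → HyperExt X S.X₂ n₁` is zero.
[folklore] -/
theorem map_delta_eq_zero (n₀ n₁ : ℤ) (h : n₀ + 1 = n₁) (x : HyperExt.{w} X S.X₃ n₀) :
    map S.f n₁ (delta hS n₀ n₁ h x) = 0 := by
  letI := HasDerivedCategory.standard C
  apply homAddEquiv.injective
  rw [homAddEquiv_map, homAddEquiv_delta, map_zero]
  exact ConcreteCategory.congr_hom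
    ((preadditiveCoyoneda.obj (op ((singleFunctor C 0).obj X))).homologySequenceδ_comp
      (triangleOfSES hS) (triangleOfSES_distinguished hS) n₀ n₁ h) (homAddEquiv x)

include hS in
/-- Exactness of `HyperExt X S.X₁ n → HyperExt X S.X₂ n → HyperExt X S.X₃ n`.
[cite: Weibel1994, Example 10.4.9 and Example 10.2.8] -/
theorem exact₂ (n : ℤ) :
    (ShortComplex.mk (AddCommGrpCat.ofHom (map (X := X) S.f n))
      (AddCommGrpCat.ofHom (map S.g n)) (by ext x; exact map_comp_map_eq_zero x)).Exact := by
  letI := HasDerivedCategory.standard C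
  have := (preadditiveCoyoneda.obj (op ((singleFunctor C 0).obj X))).homologySequence_exact₂ _
    (triangleOfSES_distinguished hS) n
  rw [ShortComplex.ab_exact_iff_function_exact] at this ⊢
  apply Function.Exact.of_ladder_addEquiv_of_exact' (e₁ := homAddEquiv)
    (e₂ := homAddEquiv) (e₃ := homAddEquiv) (H := this)
  all_goals ext x; exact (homAddEquiv_map _ x).symm

/-- Exactness of `HyperExt X S.X₂ n₀ → HyperExt X S.X₃ n₀ → HyperExt X S.X₁ n₁`.
[cite: Weibel1994, Example 10.4.9 and Example 10.2.8] -/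
theorem exact₃ (n₀ n₁ : ℤ) (h : n₀ + 1 = n₁) :
    (ShortComplex.mk (AddCommGrpCat.ofHom (map (X := X) S.g n₀))
      (AddCommGrpCat.ofHom (delta hS n₀ n₁ h))
      (by ext x; exact delta_map_eq_zero hS n₀ n₁ h x)).Exact := by
  letI := HasDerivedCategory.standard C
  have := (preadditiveCoyoneda.obj (op ((singleFunctor C 0).obj X))).homologySequence_exact₃ _
    (triangleOfSES_distinguished hS) n₀ n₁ h
  rw [ShortComplex.ab_exact_iff_function_exact] at this ⊢
  apply Function.Exact.of_ladder_addEquiv_of_exact' (e₁ := homAddEquiv)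
    (e₂ := homAddEquiv) (e₃ := homAddEquiv) (H := this)
  · ext x; exact (homAddEquiv_map _ x).symm
  · ext x; exact (homAddEquiv_delta hS n₀ n₁ h x).symm

/-- Exactness of `HyperExt X S.X₃ n₀ → HyperExt X S.X₁ n₁ → HyperExt X S.X₂ n₁`.
[cite: Weibel1994, Example 10.4.9 and Example 10.2.8] -/
theorem exact₁ (n₀ n₁ : ℤ) (h : n₀ + 1 = n₁) :
    (ShortComplex.mk (AddCommGrpCat.ofHom (delta (X := X) hS n₀ n₁ h))
      (AddCommGrpCat.ofHom (map S.f n₁))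
      (by ext x; exact map_delta_eq_zero hS n₀ n₁ h x)).Exact := by
  letI := HasDerivedCategory.standard C
  have := (preadditiveCoyoneda.obj (op ((singleFunctor C 0).obj X))).homologySequence_exact₁ _
    (triangleOfSES_distinguished hS) n₀ n₁ h
  rw [ShortComplex.ab_exact_iff_function_exact] at this ⊢
  apply Function.Exact.of_ladder_addEquiv_of_exact' (e₁ := homAddEquiv)
    (e₂ := homAddEquiv) (e₃ := homAddEquiv) (H := this)
  · ext x; exact (homAddEquiv_delta hS n₀ n₁ h x).symm
  · ext x; exact (homAddEquiv_map _ x).symm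

/-- The **long exact sequence of hyper-Ext groups** of a short exact sequence of cochain
complexes `0 → S.X₁ → S.X₂ → S.X₃ → 0`, as six composable arrows
`HyperExt X S.X₁ n₀ → HyperExt X S.X₂ n₀ → HyperExt X S.X₃ n₀ →δ HyperExt X S.X₁ n₁ → ⋯`
(`n₀ + 1 = n₁`).
[cite: Weibel1994, Example 10.4.9 and Example 10.2.8] -/
noncomputable def sequence (n₀ n₁ : ℤ) (h : n₀ + 1 = n₁) : ComposableArrows AddCommGrpCat.{w} 5 :=
  ComposableArrows.mk₅ (AddCommGrpCat.ofHom (map (X := X) S.f n₀))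
    (AddCommGrpCat.ofHom (map S.g n₀))
    (AddCommGrpCat.ofHom (delta hS n₀ n₁ h)) (AddCommGrpCat.ofHom (map S.f n₁))
    (AddCommGrpCat.ofHom (map S.g n₁))

/-- The long exact sequence `sequence hS n₀ n₁ h` is exact.
[cite: Weibel1994, Example 10.4.9 and Example 10.2.8] -/
theorem sequence_exact (n₀ n₁ : ℤ) (h : n₀ + 1 = n₁) : (sequence X hS n₀ n₁ h).Exact :=
  ComposableArrows.exact_of_δ₀ (exact₂ X hS n₀).exact_toComposableArrows
    (ComposableArrows.exact_of_δ₀ (exact₃ X hS n₀ n₁ h).exact_toComposableArrows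
      (ComposableArrows.exact_of_δ₀ (exact₁ X hS n₀ n₁ h).exact_toComposableArrows
        (exact₂ X hS n₁).exact_toComposableArrows))

include hS in
/-- Exactness at `HyperExt X S.X₂ n`, element form.
[cite: Weibel1994, Example 10.4.9 and Example 10.2.8] -/
theorem exact₂_apply (n : ℤ) : Function.Exact (map (X := X) S.f n) (map S.g n) :=
  (ShortComplex.ab_exact_iff_function_exact _).mp (exact₂ X hS n)

/-- Exactness at `HyperExt X S.X₃ n₀`, element form.
[cite: Weibel1994, Example 10.4.9 and Example 10.2.8] -/
theorem exact₃_apply (n₀ n₁ : ℤ) (h : n₀ + 1 = n₁) :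
    Function.Exact (map (X := X) S.g n₀) (delta hS n₀ n₁ h) :=
  (ShortComplex.ab_exact_iff_function_exact _).mp (exact₃ X hS n₀ n₁ h)

/-- Exactness at `HyperExt X S.X₁ n₁`, element form.
[cite: Weibel1994, Example 10.4.9 and Example 10.2.8] -/
theorem exact₁_apply (n₀ n₁ : ℤ) (h : n₀ + 1 = n₁) :
    Function.Exact (delta (X := X) hS n₀ n₁ h) (map S.f n₁) :=
  (ShortComplex.ab_exact_iff_function_exact _).mp (exact₁ X hS n₀ n₁ h)

variable {X} in
omit hS [HasHyperExt.{w} X S.X₁] [HasHyperExt.{w} X S.X₂] [HasHyperExt.{w} X S.X₃] in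
/-- **Naturality of the connecting homomorphism** with respect to morphisms of short exact
sequences of complexes. [cite: Weibel1994, Example 10.4.9 and Example 10.2.8] -/
theorem delta_naturality {S₁ S₂ : ShortComplex (CochainComplex C ℤ)} (h₁ : S₁.ShortExact)
    (h₂ : S₂.ShortExact) (φ : S₁ ⟶ S₂) [HasHyperExt.{w} X S₁.X₁] [HasHyperExt.{w} X S₁.X₃]
    [HasHyperExt.{w} X S₂.X₁] [HasHyperExt.{w} X S₂.X₃] (n₀ n₁ : ℤ) (h : n₀ + 1 = n₁)
    (x : HyperExt.{w} X S₁.X₃ n₀) :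
    delta h₂ n₀ n₁ h (map φ.τ₃ n₀ x) = map φ.τ₁ n₁ (delta h₁ n₀ n₁ h x) := by
  letI := HasDerivedCategory.standard C
  apply homAddEquiv.injective
  rw [homAddEquiv_delta, homAddEquiv_map, homAddEquiv_map, homAddEquiv_delta]
  exact ConcreteCategory.congr_hom
    ((preadditiveCoyoneda.obj (op ((singleFunctor C 0).obj X))).homologySequenceδ_naturality
      (triangleOfSES h₁) (triangleOfSES h₂) (triangleOfSES.map h₁ h₂ φ) n₀ n₁ h) (homAddEquiv x)

end LES


/-! ### Vanishing below the bottom degree -/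

section Vanishing

variable {X : C} {K : CochainComplex C ℤ} [HasHyperExt.{w} X K] {n : ℤ}

/-- `HyperExt X K n = 0` for `n < a` when `K` is cohomologically concentrated in degrees
`≥ a` (`Hom(D^{≤0}, D^{≥1}) = 0` for the canonical t-structure). [folklore] -/
theorem eq_zero_of_isGE (a : ℤ) [K.IsGE a] (hn : n < a) (x : HyperExt.{w} X K n) : x = 0 := by
  letI := HasDerivedCategory.standard C
  apply homAddEquiv.injective
  rw [map_zero]
  have : ((Q.obj K)⟦n⟧).IsGE (a - n) := TStructure.t.isGE_shift _ a n (a - n) (by lia)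
  exact TStructure.t.zero (homAddEquiv x) 0 (a - n) (by lia)

/-- `HyperExt X K n` is trivial for `n < a` when `K` is cohomologically `≥ a`. [folklore] -/
theorem subsingleton_of_isGE (a : ℤ) [K.IsGE a] (hn : n < a) :
    Subsingleton (HyperExt.{w} X K n) :=
  ⟨fun x y => by rw [eq_zero_of_isGE a hn x, eq_zero_of_isGE a hn y]⟩

end Vanishing

/-! ### Comparison with `Abelian.Ext` (complexes concentrated in degree `0`) -/

section Ext

variable [HasExt.{w} C] (X Y : C)

/-- `Ext X Y n` is, by definition, `HyperExt X Y[0] n`. [folklore] -/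
theorem ext_eq_hyperExt (n : ℕ) :
    Abelian.Ext.{w} X Y n = HyperExt.{w} X ((CochainComplex.singleFunctor C 0).obj Y) n :=
  rfl

/-- The identification `Ext X Y n ≃+ HyperExt X Y[0] n` (the identity map: both sides are
the same shrunk Hom-type with the same transported group structure). [folklore] -/
noncomputable def extEquiv (n : ℕ) :
    Abelian.Ext.{w} X Y n ≃+ HyperExt.{w} X ((CochainComplex.singleFunctor C 0).obj Y) n :=
  AddEquiv.refl _

variable {X Y}

/-- `extEquiv` is compatible with the comparison maps to the derived category. [folklore] -/
theorem hom_extEquiv [HasDerivedCategory.{w'} C] {n : ℕ} (x : Abelian.Ext.{w} X Y n) :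
    hom (extEquiv X Y n x) = x.hom :=
  rfl

/-- Under `extEquiv`, postcomposition with `Ext.mk₀ f` is `map f[0]`. [folklore] -/
theorem extEquiv_comp_mk₀ {Y' : C} {n : ℕ} (x : Abelian.Ext.{w} X Y n) (f : Y ⟶ Y') :
    extEquiv X Y' n (x.comp (Abelian.Ext.mk₀ f) (add_zero n)) =
      map ((CochainComplex.singleFunctor C 0).map f) n (extEquiv X Y n x) := by
  letI := HasDerivedCategory.standard C
  apply homAddEquiv.injective
  rw [homAddEquiv_map]
  change (x.comp (Abelian.Ext.mk₀ f) (add_zero n)).hom = x.hom ≫ _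
  rw [← Abelian.Ext.hom_comp_singleFunctor_map_shift]
  rfl

end Ext

/-! ### Two-term complexes `[A ⟶ B]` -/

section TwoTerm

variable [HasExt.{w} C] (X : C) {A B : C} (f : A ⟶ B)

/-- The **two-term complex** `[A →f B]` (`A` in degree `0`, `B` in degree `1`), realised as
the mapping cocone of `f[0] : A[0] ⟶ B[0]`, so that it sits in the distinguished triangle
`[A → B] ⟶ A[0] ⟶f B[0] ⟶ [A → B]⟦1⟧` (the two-column case of the stupid filtration).
[folklore] -/
noncomputable abbrev twoTermComplex : CochainComplex C ℤ :=
  CochainComplex.mappingCocone ((CochainComplex.singleFunctor C 0).map f)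

/-- `[A → B]` is concentrated in degrees `≥ 0`. [folklore] -/
instance twoTermComplex_isStrictlyGE : (twoTermComplex f).IsStrictlyGE 0 := by
  rw [CochainComplex.isStrictlyGE_iff]
  intro i hi
  refine IsZero.of_iso ?_
    ((CochainComplex.mappingCone _).shiftFunctorObjXIso (-1) i (i + (-1)) rfl)
  rw [CochainComplex.mappingCone.isZero_X_iff]
  exact ⟨HomologicalComplex.isZero_single_obj_X _ _ _ _ (by lia),
    HomologicalComplex.isZero_single_obj_X _ _ _ _ (by lia)⟩

/-- `[A → B]` is concentrated in degrees `≤ 1`. [folklore] -/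
instance twoTermComplex_isStrictlyLE : (twoTermComplex f).IsStrictlyLE 1 := by
  rw [CochainComplex.isStrictlyLE_iff]
  intro i hi
  refine IsZero.of_iso ?_
    ((CochainComplex.mappingCone _).shiftFunctorObjXIso (-1) i (i + (-1)) rfl)
  rw [CochainComplex.mappingCone.isZero_X_iff]
  exact ⟨HomologicalComplex.isZero_single_obj_X _ _ _ _ (by lia),
    HomologicalComplex.isZero_single_obj_X _ _ _ _ (by lia)⟩

/-- `HyperExt X [A → B] n` is defined. [folklore] -/
instance hasHyperExt_twoTermComplex : HasHyperExt.{w} X (twoTermComplex f) :=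
  hasHyperExt_of_isGE X _ 0

omit [HasExt.{w} C] in
set_option backward.isDefEq.respectTransparency false in
/-- In the mapping cocone `[K → L]⟦-1⟧`-model, the differential from the `K`-column to the
`L`-column is `-φ`: `inl ≫ d ≫ snd = -φ` degreewise. [folklore] -/
@[reassoc]
theorem mappingCocone_inl_v_d_snd_v {K L : CochainComplex C ℤ} (φ : K ⟶ L) (p q : ℤ)
    (hpq : p + 1 = q) :
    (CochainComplex.mappingCocone.inl φ).v p p (add_zero p) ≫
      (CochainComplex.mappingCocone φ).d p q ≫
        (CochainComplex.mappingCocone.snd φ).v q p (by lia) = -φ.f p := by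
  subst hpq
  simp [CochainComplex.mappingCocone, CochainComplex.mappingCocone.inl,
    CochainComplex.mappingCocone.snd,
    CochainComplex.HomComplex.Cochain.rightShift_v _ (-1) 0 (zero_add _) p p (add_zero p)
      (p + -1) (by lia),
    CochainComplex.HomComplex.Cochain.leftShift_v _ (-1) (-1) (zero_add _) (p + 1) p (by lia)
      p (by lia),
    CochainComplex.mappingCone.inl_v_d_assoc φ p (p + -1) (p + 1) (by lia) (by lia),
    Int.negOnePow_even 2 ⟨1, rfl⟩]

omit [HasExt.{w} C] in
set_option backward.isDefEq.respectTransparency false in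
/-- The degree-`0` term of `[A → B]` is `A`: the projection `fst` (with inverse `inl`).
[folklore] -/
noncomputable def twoTermComplexXZeroIso : (twoTermComplex f).X 0 ≅ A where
  hom := (CochainComplex.mappingCocone.fst _).f 0 ≫
    (HomologicalComplex.singleObjXSelf (ComplexShape.up ℤ) 0 A).hom
  inv := (HomologicalComplex.singleObjXSelf (ComplexShape.up ℤ) 0 A).inv ≫
    (CochainComplex.mappingCocone.inl _).v 0 0 (add_zero 0)
  hom_inv_id := by
    have h := CochainComplex.mappingCocone.id_X ((CochainComplex.singleFunctor C 0).map f) 0 (-1)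
      (by lia)
    have hz : (CochainComplex.mappingCocone.snd ((CochainComplex.singleFunctor C 0).map f)).v
        0 (-1) (by lia) = 0 :=
      (HomologicalComplex.isZero_single_obj_X _ _ _ _ (by simp)).eq_of_tgt _ _
    rw [hz, zero_comp, add_zero] at h
    simp [h]
  inv_hom_id := by simp

omit [HasExt.{w} C] in
set_option backward.isDefEq.respectTransparency false in
/-- The degree-`1` term of `[A → B]` is `B`: the projection `snd` (with inverse `inr`).
[folklore] -/
noncomputable def twoTermComplexXOneIso : (twoTermComplex f).X 1 ≅ B where
  hom := (CochainComplex.mappingCocone.snd _).v 1 0 (by lia) ≫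
    (HomologicalComplex.singleObjXSelf (ComplexShape.up ℤ) 0 B).hom
  inv := (HomologicalComplex.singleObjXSelf (ComplexShape.up ℤ) 0 B).inv ≫
    (CochainComplex.mappingCocone.inr _).1.v 0 1 (by lia)
  hom_inv_id := by
    have h := CochainComplex.mappingCocone.id_X ((CochainComplex.singleFunctor C 0).map f) 1 0
      (by lia)
    have hz : (CochainComplex.mappingCocone.fst ((CochainComplex.singleFunctor C 0).map f)).f
        1 = 0 :=
      (HomologicalComplex.isZero_single_obj_X _ _ _ _ (by simp)).eq_of_tgt _ _
    rw [hz, zero_comp, zero_add] at h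
    simp [h]
  inv_hom_id := by simp

omit [HasExt.{w} C] in
set_option backward.isDefEq.respectTransparency false in
/-- **The differential of `[A → B]` is `-f`** in the coordinates `twoTermComplexXZeroIso`,
`twoTermComplexXOneIso` (the sign comes from the shift `⟦-1⟧` in the mapping cocone; the complex
is isomorphic to the one with differential `f` via `-1` on one term). [folklore] -/
theorem twoTermComplex_d :
    (twoTermComplexXZeroIso f).inv ≫ (twoTermComplex f).d 0 1 ≫ (twoTermComplexXOneIso f).hom =
      -f := by
  simp only [twoTermComplexXZeroIso, twoTermComplexXOneIso, Category.assoc,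
    mappingCocone_inl_v_d_snd_v_assoc _ 0 1 (zero_add 1)]
  simp [CochainComplex.singleFunctor, CochainComplex.singleFunctors,
    HomologicalComplex.single_map_f_self]

section

variable [HasDerivedCategory.{w'} C]

/-- The distinguished triangle `[A → B] ⟶ A[0] ⟶ B[0] ⟶ [A → B]⟦1⟧` in the derived category.
[folklore] -/
noncomputable abbrev twoTermTriangle : Triangle (DerivedCategory C) :=
  Q.mapTriangle.obj
    (CochainComplex.mappingCocone.triangle ((CochainComplex.singleFunctor C 0).map f))

omit [HasExt.{w} C] in
/-- `twoTermTriangle f` is distinguished. [folklore] -/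
theorem twoTermTriangle_distinguished : twoTermTriangle f ∈ distTriang (DerivedCategory C) :=
  mappingCocone_triangle_distinguished _

end

/-- The map `HyperExt X [A → B] n →+ Extⁿ(X, A)` induced by the projection `[A → B] ⟶ A[0]`
(restriction to the degree-`0` column). [folklore] -/
noncomputable def twoTermFst (n : ℕ) :
    HyperExt.{w} X (twoTermComplex f) n →+ Abelian.Ext.{w} X A n :=
  map (CochainComplex.mappingCocone.fst _) n

/-- The connecting map `Extⁿ⁰(X, B) →+ HyperExt X [A → B] n₁` (`n₀ + 1 = n₁`) of the
triangle `[A → B] ⟶ A[0] ⟶ B[0] ⟶ [A → B]⟦1⟧`. [folklore] -/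
noncomputable def twoTermδ (n₀ n₁ : ℕ) (h : n₀ + 1 = n₁) :
    Abelian.Ext.{w} X B n₀ →+ HyperExt.{w} X (twoTermComplex f) n₁ :=
  letI := HasDerivedCategory.standard C
  AddMonoidHom.mk' (fun x : Abelian.Ext.{w} X B n₀ => homAddEquiv.symm
      (x.hom ≫ (twoTermTriangle f).mor₃⟦(n₀ : ℤ)⟧' ≫
        (shiftFunctorAdd' (DerivedCategory C) (1 : ℤ) (n₀ : ℤ) (n₁ : ℤ) (by lia)).inv.app _))
    (fun x y => by rw [Abelian.Ext.add_hom, CategoryTheory.Preadditive.add_comp, map_add])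

variable {X f} in
/-- `twoTermδ` is the connecting map of `Hom(X[0], -)` on `twoTermTriangle f`, in the
constructed derived category. [folklore] -/
theorem homAddEquiv_twoTermδ (n₀ n₁ : ℕ) (h : n₀ + 1 = n₁) (x : Abelian.Ext.{w} X B n₀) :
    letI := HasDerivedCategory.standard C
    homAddEquiv (twoTermδ X f n₀ n₁ h x) =
      (preadditiveCoyoneda.obj (op ((singleFunctor C 0).obj X))).homologySequenceδ
        (twoTermTriangle f) n₀ n₁ (by lia) x.hom := by
  letI := HasDerivedCategory.standard C
  rw [preadditiveCoyoneda_homologySequenceδ_apply]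
  exact AddEquiv.apply_symm_apply _ _

/-- Exactness of `HyperExt X [A → B] n → Extⁿ(X, A) →f Extⁿ(X, B)`. [folklore] -/
theorem twoTerm_exact₂ (n : ℕ) :
    Function.Exact (twoTermFst X f n) ((Abelian.Ext.mk₀ f).postcomp X (add_zero n)) := by
  letI := HasDerivedCategory.standard C
  have := (preadditiveCoyoneda.obj (op ((singleFunctor C 0).obj X))).homologySequence_exact₂ _
    (twoTermTriangle_distinguished f) n
  rw [ShortComplex.ab_exact_iff_function_exact] at this
  apply Function.Exact.of_ladder_addEquiv_of_exact'
    (e₁ := homAddEquiv (X := X) (K := twoTermComplex f) (n := n))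
    (e₂ := Abelian.Ext.homAddEquiv (X := X) (Y := A) (n := n))
    (e₃ := Abelian.Ext.homAddEquiv (X := X) (Y := B) (n := n)) (H := this)
  · ext x
    exact (homAddEquiv_map (CochainComplex.mappingCocone.fst
      ((CochainComplex.singleFunctor C 0).map f)) x).symm
  · ext x; exact Abelian.Ext.hom_comp_singleFunctor_map_shift (C := C) x f

/-- Exactness of `Extⁿ⁰(X, A) →f Extⁿ⁰(X, B) →∂ HyperExt X [A → B] n₁`. [folklore] -/
theorem twoTerm_exact₃ (n₀ n₁ : ℕ) (h : n₀ + 1 = n₁) :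
    Function.Exact ((Abelian.Ext.mk₀ f).postcomp X (add_zero n₀)) (twoTermδ X f n₀ n₁ h) := by
  letI := HasDerivedCategory.standard C
  have := (preadditiveCoyoneda.obj (op ((singleFunctor C 0).obj X))).homologySequence_exact₃ _
    (twoTermTriangle_distinguished f) n₀ n₁ (by lia)
  rw [ShortComplex.ab_exact_iff_function_exact] at this
  apply Function.Exact.of_ladder_addEquiv_of_exact'
    (e₁ := Abelian.Ext.homAddEquiv (X := X) (Y := A) (n := n₀))
    (e₂ := Abelian.Ext.homAddEquiv (X := X) (Y := B) (n := n₀))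
    (e₃ := homAddEquiv (X := X) (K := twoTermComplex f) (n := n₁)) (H := this)
  · ext x; exact Abelian.Ext.hom_comp_singleFunctor_map_shift (C := C) x f
  · ext x; exact (homAddEquiv_twoTermδ n₀ n₁ h x).symm

/-- Exactness of `Extⁿ⁰(X, B) →∂ HyperExt X [A → B] n₁ → Extⁿ¹(X, A)`. [folklore] -/
theorem twoTerm_exact₁ (n₀ n₁ : ℕ) (h : n₀ + 1 = n₁) :
    Function.Exact (twoTermδ X f n₀ n₁ h) (twoTermFst X f n₁) := by
  letI := HasDerivedCategory.standard C
  have := (preadditiveCoyoneda.obj (op ((singleFunctor C 0).obj X))).homologySequence_exact₁ _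
    (twoTermTriangle_distinguished f) n₀ n₁ (by lia)
  rw [ShortComplex.ab_exact_iff_function_exact] at this
  apply Function.Exact.of_ladder_addEquiv_of_exact'
    (e₁ := Abelian.Ext.homAddEquiv (X := X) (Y := B) (n := n₀))
    (e₂ := homAddEquiv (X := X) (K := twoTermComplex f) (n := n₁))
    (e₃ := Abelian.Ext.homAddEquiv (X := X) (Y := A) (n := n₁)) (H := this)
  · ext x; exact (homAddEquiv_twoTermδ n₀ n₁ h x).symm
  · ext x
    exact (homAddEquiv_map (CochainComplex.mappingCocone.fst
      ((CochainComplex.singleFunctor C 0).map f)) x).symm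

/-- In degree `0`, `HyperExt X [A → B] 0 → Hom(X, A)` is injective (its kernel receives
`Hom(X[0], B[0]⟦-1⟧) = 0`). [folklore] -/
theorem twoTermFst_injective : Function.Injective (twoTermFst X f 0) := by
  letI := HasDerivedCategory.standard C
  let F := preadditiveCoyoneda.obj (op ((singleFunctor C 0).obj X))
  have hGE : TStructure.t.IsGE ((shiftFunctor (DerivedCategory C) (-1 : ℤ)).obj
      (twoTermTriangle f).obj₃) 1 :=
    TStructure.t.isGE_shift (Q.obj ((CochainComplex.singleFunctor C 0).obj B)) 0 (-1) 1 (by lia)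
  have hZ : IsZero ((F.shift (-1 : ℤ)).obj (twoTermTriangle f).obj₃) := by
    refine @AddCommGrpCat.isZero_of_subsingleton _ ⟨fun (a b : _ ⟶ _) => ?_⟩
    exact (TStructure.t.zero a 0 1 (by lia)).trans (TStructure.t.zero b 0 1 (by lia)).symm
  have hδ : F.homologySequenceδ (twoTermTriangle f) (-1) 0 (by lia) = 0 := hZ.eq_of_src _ _
  have hmono := (F.homologySequence_mono_shift_map_mor₁_iff _ (twoTermTriangle_distinguished f)
    (-1) 0 (by lia)).2 hδ
  rw [AddCommGrpCat.mono_iff_injective] at hmono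
  intro x y hxy
  apply homAddEquiv.injective
  apply hmono
  have hx := homAddEquiv_map (CochainComplex.mappingCocone.fst
    ((CochainComplex.singleFunctor C 0).map f)) (n := 0) x
  have hy := homAddEquiv_map (CochainComplex.mappingCocone.fst
    ((CochainComplex.singleFunctor C 0).map f)) (n := 0) y
  exact hx.symm.trans ((congrArg homAddEquiv hxy).trans hy)

end TwoTerm


/-! ### Vanishing above `amplitude + projective dimension` (cohomological dimension) -/

section ProjDim

variable [HasExt.{w} C] {X : C} (d : ℕ) [HasProjectiveDimensionLE X d]

section

variable [HasDerivedCategory.{w'} C]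

/-- If `X` has projective dimension `≤ d` and `Y ∈ D(C)` has cohomology in the single degree
`b`, then `Hom(X[0], Y⟦n⟧) = 0` for `n > b + d` (it is `Extⁿ⁻ᵇ(X, H^b Y)`). [folklore] -/
theorem hom_shift_eq_zero_of_isGE_of_isLE_self (Y : DerivedCategory C) (b : ℤ) [Y.IsGE b]
    [Y.IsLE b] (n : ℤ) (hn : b + d < n) (f : (singleFunctor C 0).obj X ⟶ Y⟦n⟧) : f = 0 := by
  obtain ⟨Y', ⟨e⟩⟩ := exists_iso_singleFunctor_obj_of_isGE_of_isLE Y b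
  obtain ⟨m, hm⟩ := Int.eq_ofNat_of_zero_le (show 0 ≤ n - b by lia)
  let E : Y⟦n⟧ ≅ ((singleFunctor C 0).obj Y')⟦(m : ℤ)⟧ :=
    (shiftFunctor _ n).mapIso (e ≪≫ (((singleFunctors C).shiftIso (-b) b 0 (by lia)).app Y').symm)
      ≪≫ ((shiftFunctorAdd' (DerivedCategory C) (-b) n m (by lia)).app _).symm
  have hg : f ≫ E.hom = 0 := by
    have h₁ : (Abelian.Ext.homEquiv (X := X) (Y := Y') (n := m)).symm (f ≫ E.hom) = 0 :=
      Abelian.Ext.eq_zero_of_hasProjectiveDimensionLT _ (d + 1) (by lia)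
    have h₂ : f ≫ E.hom = ((Abelian.Ext.homEquiv (X := X) (Y := Y') (n := m)).symm
        (f ≫ E.hom)).hom :=
      (Equiv.apply_symm_apply _ _).symm
    rw [h₂, h₁, Abelian.Ext.zero_hom]
  rw [← cancel_mono E.hom, hg, zero_comp]

/-- If `X` has projective dimension `≤ d` and `Y ∈ D(C)` has cohomology in degrees
`[a, a + k]`, then `Hom(X[0], Y⟦n⟧) = 0` for `n > a + k + d` (devissage on the canonical
truncation triangles). [folklore] -/
theorem hom_shift_eq_zero_of_isGE_of_isLE (k : ℕ) :
    ∀ (Y : DerivedCategory C) (a : ℤ) [Y.IsGE a] [Y.IsLE (a + k)] (n : ℤ) (_ : a + k + d < n)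
      (f : (singleFunctor C 0).obj X ⟶ Y⟦n⟧), f = 0 := by
  induction k with
  | zero =>
    intro Y a _ hY n hn f
    have : Y.IsLE a := by simpa using hY
    exact hom_shift_eq_zero_of_isGE_of_isLE_self d Y a n (by simpa using hn) f
  | succ k hk =>
    intro Y a _ _ n hn f
    have h₁ : TStructure.t.IsLE ((TStructure.t.truncLT (a + k + 1)).obj Y) (a + k) := inferInstance
    have h₃ : TStructure.t.IsLE ((TStructure.t.truncGE (a + k + 1)).obj Y) (a + k + 1) := by
      have : TStructure.t.IsLE Y (a + k + 1) := by
        rw [add_assoc]; exact (inferInstance : Y.IsLE (a + (↑k + 1 : ℕ)))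
      infer_instance
    have ex := (preadditiveCoyoneda.obj (op ((singleFunctor C 0).obj X))).homologySequence_exact₂
      _ (TStructure.t.triangleLTGE_distinguished (a + k + 1) Y) n
    rw [ShortComplex.ab_exact_iff] at ex
    obtain ⟨g, hg⟩ := ex f
      (hom_shift_eq_zero_of_isGE_of_isLE_self d ((TStructure.t.truncGE (a + k + 1)).obj Y)
        (a + k + 1) n (by push_cast at hn; lia) _)
    have hg0 : g = 0 :=
      hk ((TStructure.t.truncLT (a + k + 1)).obj Y) a n (by push_cast at hn; lia) g
    rw [← hg, hg0, map_zero]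
    rfl

end

variable {K : CochainComplex C ℤ} [HasHyperExt.{w} X K] {n : ℤ}

/-- **Vanishing of hyper-Ext above amplitude plus projective dimension**: if every
`Extⁱ(X, -)` vanishes for `i > d` (`HasProjectiveDimensionLE X d`; for `X = ℤ` on a space:
cohomological dimension `≤ d`) and `K` is cohomologically concentrated in degrees `[a, b]`,
then `HyperExt X K n = 0` for `n > b + d`. For `K` in degrees `[0, r - 1]` this is the
vanishing `ℍⁿ(K) = 0` for `n > d + r - 1`. [folklore] -/
theorem eq_zero_of_hasProjectiveDimensionLE (a b : ℤ) [K.IsGE a] [K.IsLE b] (hn : b + d < n)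
    (x : HyperExt.{w} X K n) : x = 0 := by
  letI := HasDerivedCategory.standard C
  apply homAddEquiv.injective
  rw [map_zero]
  by_cases hab : a ≤ b
  · obtain ⟨k, rfl⟩ := Int.le.dest hab
    exact hom_shift_eq_zero_of_isGE_of_isLE d k (Q.obj K) a n (by lia) (homAddEquiv x)
  · exact (Functor.map_isZero (shiftFunctor (DerivedCategory C) n)
      (TStructure.t.isZero (Q.obj K) b a (by lia))).eq_of_tgt _ _

variable (X) in
/-- **Top-corner surjection** for a two-term complex: if `Extⁱ(X, -) = 0` for `i > d`, the
connecting map `Extᵈ(X, B) → HyperExt X [A → B] (d + 1)` is surjective (its cokernel embeds in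
`Extᵈ⁺¹(X, A) = 0`). [folklore] -/
theorem twoTermδ_surjective {A B : C} (f : A ⟶ B) :
    Function.Surjective (twoTermδ X f d (d + 1) rfl) := fun y =>
  ((twoTerm_exact₁ X f d (d + 1) rfl) y).mp
    (Abelian.Ext.eq_zero_of_hasProjectiveDimensionLT _ (d + 1) le_rfl)

end ProjDim

end HyperExt

end HyperExt

end Literature.Algebra.Homology
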